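import Summits.QuantumFields.BalabanUV.T4Continuum.Support.NE9CurveSpeciesCouplingEnd
import Summits.QuantumFields.BalabanUV.T4Continuum.Support.NE9ChannelSumMargProj

/-!
# NE9SizeFedCoupling — the NE9 END faces with SIZE-FED coupling moduli: leaf A3's `hTcup` may be supplied by a producer that
# takes the inductive size (1.18) `TermSize E W κ N` as INPUT, because the face proves `TermSize` FIRST from one-history binders;
# generic in the channel and the projection, then for the ASSEMBLED channel `T_a + T_b`, then species (a)'s producer at the curve
# datum (cell `pub-balaban`, T4-DAG §2 node U3 ∕ §6 NE9; NE9 formalisation swarm, unit `b2b-balaban-t4-ne9-formalise-leaf-05` gen 5;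
# own-lineage follow-through «A3-FED» of crew row (w20), CLAIMS.log (this module's CLAIM line); at own risk)

HONEST FRAMING (T4-DAG PAGE 1).  Rung (B)+1 of the FINITE-VOLUME T⁴ programme — existence AND uniqueness of the ε → 0 limit
of gauge-invariant observables on a fixed torus; NOT infinite volume, NOT a mass gap, NOT the Clay problem.  NE9
(`T4OutputRate.NE9` ∧ `FadingMemory`) is a cell NEW ESTIMATE, NOT PRINTED, and is NOT discharged here («NE9 ⇐ the named
binders»); spine 0∕9; 0∕18 skeleton leaves instantiated on Bałaban's objects (O-NE9-1).  HONEST DEPENDENCY (cell line,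
verbatim): continuum YM on T⁴ ⇐ BetaPertH ∧ nine spine estimates (0/9 proved); BetaPertH ⇐ (D1) ∧ (D4) ∧ CAP+tail; G-an2-4
gates asym, D1 and NE2/3/4.  [I] = [Balaban1987RG1] (CMP **109**), [II] = [Balaban1988RG2Cluster] (CMP **116**) are quoted for
TYPES only (ABSOLUTE RULE: nothing printed in the audited series is asserted).  No `def`, no Prop-valued definition;
`FlowStep.BetaPertH`, (B), (B^μ) do not occur.

THE WRINKLE, ONCE AND FOR ALL.  Every species-level producer of leaf A3 on the read-out dictionary (`channelCouplingModulus_cpiece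
_margProj`, p212551; fed by A3-REM ∕ A3-CUR ∕ A3-KER) needs the family's inductive size `TermSize E W κ N` (the read-out coefficient
of the marginal projection is bounded through RO `ReadSize` on it), while the END faces OUTPUT `TermSize`.  A3-REM-END (p213409) and
this lineage's A3-CUR-END (p214812) each resolved it by hand: `TermSize` FIRST from END-M's internal route (size induction
`NE9BridgeSizeInduction.termSize_of_recursion_vacSub` ∘ `channelSizeNN_of_perStepNN` ∘ `channelStepSum_compProj` ∕
`channelSizeAtStepNN_compProj`), which uses ONE-HISTORY binders only — no coupling modulus, no circularity.  THIS FILE states that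
route as lemmas, so every present and future A3 discharge (the kernel species' END, the assembled species channel) is ONE `exact`:
* §1 **`termSize_compProj`** — `TermSize E W κ N` from the one-history binders of END-M's `…_compProj` face (S1, `AdmRestrict`,
  `ProjScaleComm` ∕ `ProjInto` ∕ `ProjSize`, `ChannelStepSum` ∕ `ChannelSizeAtStepNN` on the marginal-free class, `Factorises`, KP ∧
  decay ∧ pins, `hreprV`, (XZ), (B0), (N′), the box read-out) — generic in the channel `𝒯` and the projection `P`.
* §2 **`termSize_ne9_and_fadingMemory_compProj_fed`** ∕ **`…_margProj_fed`** — END-M's two faces with the binder `hTcup` REPLACED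
  by a SIZE-FED producer `hTcupFed : TermSize E W κ N → (hTcup)`; conclusions END-M's verbatim.
* §3 **`termSize_ne9_and_fadingMemory_margProj_sum_fed`** — leaf-04-g6's (w25)-M face for the ASSEMBLED channel `T_a + T_b`
  (p214472 §2, read-out projection) with BOTH summands' moduli size-fed (`hTcupaFed`, `hTcupbFed`); conclusion p214472's verbatim.
* §4 **`tcupFed_cur_margProj`** — species (a)'s size-fed producer at the CURVE datum on the read-out dictionary: from the (w20)
  binders of `cpieceResponse_cur` ((c1)–(c3), `hhalf`, scalars), `CurData.Admissible`, the counts, (w19)'s additivity, S1 ⊆ analytic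
  class, AW (`A` analytic, `DirSize`), `hAmul`, RO `ReadSize` — `TermSize Ef W κ N →` the `hTcup`∕`hTcupa` shape at
  `compProj (cpieceChannel Dc.toC) (margProj r A)` with weight `weightOf Dc.toC.frame κ₁ d₀ O1 (Dc.Kp c_dir)` and the k-uniform
  `qT := (64·cA·Nbar + cr·Nbar·(64·cA·aA))·c_Q·(1−ω)⁻¹` (p212551 §3 fed with `cpieceResponse_cur` ∕ `cpieceResponseA_cur`).  With
  §3 this plugs species (a)'s A3 into the assembled-channel END BY NAME; species (b)'s fed producer is A3-KER's business
  (`cpieceResponse_ker` + its `hrespA` twin, leaf-09 lineage) and plugs into the same socket.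
NOT PRINTED and not claimed: anything about Bałaban's objects (O-NE9-1 ∕ O-NE9-5).  DISGUISE TEST: bookkeeping of binder order;
every coupling clause compares the SAME family at two coupling arguments; not NE9.

WHAT IS PROVED (kernel, `[folklore]` bookkeeping; 0 sorry, 0 `def`): §1 `termSize_compProj`; §2 `termSize_ne9_and_fadingMemory_compProj_fed`,
`termSize_ne9_and_fadingMemory_margProj_fed`; §3 `termSize_ne9_and_fadingMemory_margProj_sum_fed`; §4 `tcupFed_cur_margProj`.

References (TYPES only): [Balaban1987RG1] T. Bałaban, CMP **109** (1987) 249–301, (0.28)–(0.30) p. 258, (1.3) p. 260, (1.18) p. 263,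
(1.20)–(1.22) p. 264, (2.12)–(2.14) p. 268, (3.53)–(3.54) p. 280; [Balaban1988RG2Cluster] T. Bałaban, CMP **116** (1988) 1–22,
(1.21)–(1.29) pp. 7–8, (1.33)–(1.36) p. 9, (2.14)–(2.15) p. 15, Lemma 3 (2.38) p. 20, (2.41) p. 21.  Summits-side NEW work (LEAN
PLACEMENT RULE); imports this lineage's `NE9CurveSpeciesCouplingEnd` and leaf-04-g6's `NE9ChannelSumMargProj` (hence END-M,
`NE9BridgeSizeInduction`, `NE9MarginalProjection`, leaf-07-g5's `NE9ChannelSum`, p212551) BY NAME; modifies nothing; no END face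
re-wired (new faces beside the old).  Value = the A3 socket of the END made size-fed once, NOT summit progress.
-/

noncomputable section

namespace Summit.QuantumFields.BalabanUV.T4Continuum.NE9SizeFedCoupling

open scoped BigOperators
open Metric Set
open Literature.MathematicalPhysics.QuantumFieldTheory.Balaban1983to89
open Literature.MathematicalPhysics.QuantumFieldTheory.Balaban1983to89.T4OutputRate
open Literature.MathematicalPhysics.QuantumFieldTheory.Balaban1983to89.T4HistoryLipschitzRecursion
open Literature.MathematicalPhysics.QuantumFieldTheory.Balaban1983to89.T4HistoryLipschitzOuter
open Literature.MathematicalPhysics.QuantumFieldTheory.Balaban1983to89.T4HistoryLipschitzActivity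
open Literature.MathematicalPhysics.QuantumFieldTheory.Balaban1983to89.T4HistoryLipschitzActivity (ClusterGeom)
open Literature.MathematicalPhysics.QuantumFieldTheory.Balaban1983to89.T4HistoryLipschitzSegment
open Summit.QuantumFields.BalabanUV.T4Continuum.NE9Lemma1Counting
open Summit.QuantumFields.BalabanUV.T4Continuum.NE9Lemma1Gain
open Summit.QuantumFields.BalabanUV.T4Continuum.NE9Lemma1PieceClass
open Summit.QuantumFields.BalabanUV.T4Continuum.NE9Lemma1RemainderSpecies
open Summit.QuantumFields.BalabanUV.T4Continuum.NE9Lemma1CurveSpecies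
open Summit.QuantumFields.BalabanUV.T4Continuum.NE9Lemma1RemainderSpeciesEnd (pieceAdditiveOn_mono)
open Summit.QuantumFields.BalabanUV.T4Continuum.NE9ComplexEncoding (doubleCarriers)
open Summit.QuantumFields.BalabanUV.T4Continuum.NE9LastCouplingBridge
open Summit.QuantumFields.BalabanUV.T4Continuum.NE9BridgeSizeInduction
open Summit.QuantumFields.BalabanUV.T4Continuum.NE9MarginalProjection
open Summit.QuantumFields.BalabanUV.T4Continuum.NE9MarginalProjectionEnd
open Summit.QuantumFields.BalabanUV.T4Continuum.NE9CPieceCouplingModulus (channelCouplingModulus_cpiece_margProj)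
open Summit.QuantumFields.BalabanUV.T4Continuum.NE9ChannelSum (channelStepSum_add channelSizeAtStepNN_add)
open Summit.QuantumFields.BalabanUV.T4Continuum.NE9ChannelSumMargProj (termSize_ne9_and_fadingMemory_margProj_sum)
open Summit.QuantumFields.BalabanUV.T4Continuum.NE9CurveSpeciesCoupling (cpieceResponse_cur)
open Summit.QuantumFields.BalabanUV.T4Continuum.NE9CurveSpeciesCouplingEnd (cpieceResponseA_cur)

variable {C : Carriers} {Bg : Type} {ι : Type}

/-! ## §1 The inductive size (1.18) from ONE-HISTORY binders of END-M's `…_compProj` face -/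

section Generic

variable (G : ClusterGeom C) {Pot : Type*} [NormedAddCommGroup Pot] [NormedSpace ℂ Pot]

omit [NormedSpace ℂ Pot] in
/-- **`TermSize` FIRST (kernel).**  From the ONE-HISTORY binders of END-M's `…_compProj` face — S1 `AdmissibleTerms`, `AdmRestrict`,
the projection's `ProjScaleComm` ∕ `ProjInto` ∕ `ProjSize` (constant `c ≥ 0`), the channel's `ChannelStepSum` ∕ `ChannelSizeAtStepNN`
ON THE MARGINAL-FREE CLASS, `Factorises`, TWO-POINT KP ∧ decay ∧ pin budget, the representation `hreprV`, (XZ) `hexplZ`, (B0)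
`hbase`, (N′) `hNsucc` ∕ `hNnn`, the box read-out `hbox` — the family obeys `TermSize E W κ N`.  This is END-M's own internal route
(`NE9BridgeSizeInduction.termSize_of_recursion_vacSub` ∘ `channelSizeNN_of_perStepNN` ∘ `channelStepSum_compProj` ∕
`channelSizeAtStepNN_compProj`), isolated: NO coupling modulus, NO `ChannelAdditive`, NO `ProjAdditive` is used.
[cite: Balaban1987RG1, (1.18) p.263, (0.23) p.256; Balaban1988RG2Cluster, (1.36) p.9, (2.41) p.21] -/
theorem termSize_compProj {E : Functional C Bg} {W : Set (ℕ → ℝ)} {Adm MF : Set (Bg → C.Dom → ℝ)}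
    {P : (Bg → C.Dom → ℝ) → (Bg → C.Dom → ℝ)} {𝒯 : ℕ → (ℕ → ℝ) → (Bg → C.Dom → ℝ) → ι → ℝ}
    {Ψ : ℕ → ℝ → (ι → ℝ) → Bg → C.Dom → ℝ} {act : ℕ → ℝ → Bg → Pot → G.P → ℂ} {𝒜 : ℕ → Set Pot}
    {n : ℕ → ℝ → Bg → G.P → ℝ} {lip : ℕ → ℝ} {a d : G.P → ℝ} {δ : C.Dom → ℝ}
    {κ B c : ℝ} {wt : ℕ → ι → ℝ} {τ : ℕ → ℕ → ℝ} {p₀ N : ℕ → ℝ}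
    (ρ : ℕ → (ι → ℝ) → Pot) (U₀ : Bg) (explZ : ℕ → Bg → C.Dom → ℝ)
    (hAdm : AdmissibleTerms E W Adm) (hres : AdmRestrict Adm)
    (hPcomm : ProjScaleComm Adm P) (hPinto : ProjInto Adm MF P) (hPsize : ProjSize Adm P κ c) (hc : 0 ≤ c)
    (hsum : ChannelStepSum MF 𝒯) (hstep : ChannelSizeAtStepNN MF 𝒯 κ wt τ)
    (hfac : Factorises E W (compProj 𝒯 P) Ψ)
    (hreprV : ∀ (k : ℕ) (s : ℝ) (Q : ι → ℝ) (U : Bg) (X : C.Dom),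
      Ψ k s Q U X = (G.newTerm act k s U X (ρ k Q)).re - (G.newTerm act k s U₀ X (ρ k Q)).re + explZ k U X)
    (hK : TwoPointKP G W act 𝒜 n lip a d) (hdec : G.DecayExtract δ d) (hpin : G.PinBudget a δ (fun _ => B) κ)
    (hexplZ : ∀ (k : ℕ) (U : Bg) (X : C.Dom), C.scale X = k + 1 → |explZ k U X| ≤ Real.exp (-(κ * C.d X)) * p₀ k)
    (hbase : ∀ g ∈ W, ∀ (U : Bg) (X : C.Dom), C.scale X = 0 → |E g U X| ≤ Real.exp (-(κ * C.d X)) * N 0)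
    (hNsucc : ∀ j, p₀ j + 2 * B ≤ N (j + 1)) (hNnn : ∀ j, 0 ≤ N j)
    (hbox : ∀ (k : ℕ) (Q : ι → ℝ), (∀ y, |Q y| ≤ wt k y * sizeRadius (fun k j => (1 + c) * τ k j) N k) → ρ k Q ∈ 𝒜 k) :
    TermSize E W κ N :=
  (termSize_of_recursion_vacSub G ρ U₀ explZ hAdm
    (channelSizeNN_of_perStepNN hres (channelStepSum_compProj hPcomm hPinto hsum)
      (channelSizeAtStepNN_compProj hPcomm hPinto hPsize hc hstep))
    hfac hK hdec hpin hreprV hexplZ hbase hNsucc hNnn hbox).1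

/-! ## §2 END-M's faces with a SIZE-FED coupling modulus -/

/-- **END-M `…_compProj` WITH A SIZE-FED `hTcup` (kernel).**  END-M's `ne9_and_fadingMemory_of_couplingTwoPoint_vacSub_sizeInduction
_compProj` VERBATIM except that the coupling-modulus binder is a PRODUCER `hTcupFed : TermSize E W κ N → (hTcup)`: the face feeds it
the size of §1.  Conclusion END-M's. [cite: Balaban1987RG1, (0.28)-(0.30) p.258, (1.3) p.260, (1.18) p.263, (2.12)-(2.14) p.268; Balaban1988RG2Cluster, (1.33)-(1.36) p.9, Lemma 3 (2.38) p.20] -/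
theorem termSize_ne9_and_fadingMemory_compProj_fed {E : Functional C Bg} {W : Set (ℕ → ℝ)} {Adm MF : Set (Bg → C.Dom → ℝ)}
    {P : (Bg → C.Dom → ℝ) → (Bg → C.Dom → ℝ)} {𝒯 : ℕ → (ℕ → ℝ) → (Bg → C.Dom → ℝ) → ι → ℝ}
    {Ψ : ℕ → ℝ → (ι → ℝ) → Bg → C.Dom → ℝ} {act : ℕ → ℝ → Bg → Pot → G.P → ℂ} {𝒜 : ℕ → Set Pot}
    {n : ℕ → ℝ → Bg → G.P → ℝ} {lip clip : ℕ → ℝ} {a d : G.P → ℝ} {δ : C.Dom → ℝ}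
    {κ B lipbar clipbar qTbar τbar ω c : ℝ} {wt : ℕ → ι → ℝ} {τ : ℕ → ℕ → ℝ} {qT p₀ N : ℕ → ℝ}
    (ρ : ℕ → (ι → ℝ) → Pot) (U₀ : Bg) (explZ : ℕ → Bg → C.Dom → ℝ) (h0 : ScaleZeroFree E W)
    (hAdm : AdmissibleTerms E W Adm) (hres : AdmRestrict Adm)
    (hPadd : ProjAdditive Adm P) (hPcomm : ProjScaleComm Adm P) (hPinto : ProjInto Adm MF P) (hPsize : ProjSize Adm P κ c)
    (hc : 0 ≤ c) (hadd : ChannelAdditive MF 𝒯) (hsum : ChannelStepSum MF 𝒯) (hstep : ChannelSizeAtStepNN MF 𝒯 κ wt τ)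
    (hfac : Factorises E W (compProj 𝒯 P) Ψ) (hclip0 : ∀ k, 0 ≤ clip k)
    (hCup : ∀ g ∈ W, ∀ g' ∈ W, ∀ (k : ℕ) (U : Bg) (X : C.Dom), C.scale X = k + 1 → ∀ Q ∈ 𝒜 k, ∀ γ ∈ G.vol X,
      ‖act k (g k) U Q γ‖ ≤ n k (g' k) U γ ∧
        ‖act k (g k) U Q γ - act k (g' k) U Q γ‖ ≤ clip k * |g k - g' k| * n k (g' k) U γ)
    (hqT0 : ∀ k, 0 ≤ qT k)
    (hTcupFed : TermSize E W κ N → ∀ g ∈ W, ∀ g' ∈ W, ∀ (k : ℕ) (y : ι),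
      |compProj 𝒯 P k g (E g) y - compProj 𝒯 P k g' (E g) y| ≤ wt k y * (qT k * |g k - g' k|))
    (hreprV : ∀ (k : ℕ) (s : ℝ) (Q : ι → ℝ) (U : Bg) (X : C.Dom),
      Ψ k s Q U X = (G.newTerm act k s U X (ρ k Q)).re - (G.newTerm act k s U₀ X (ρ k Q)).re + explZ k U X)
    (hclipb : ∀ k, clip k ≤ clipbar) (hqTb : ∀ k, qT k ≤ qTbar)
    (hK : TwoPointKP G W act 𝒜 n lip a d) (hdec : G.DecayExtract δ d) (hpin : G.PinBudget a δ (fun _ => B) κ)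
    (hρ : ∀ (k : ℕ) (Q Q' : ι → ℝ) (M : ℝ), (∀ y, |Q y - Q' y| ≤ wt k y * M) → ‖ρ k Q - ρ k Q'‖ ≤ M)
    (hexplZ : ∀ (k : ℕ) (U : Bg) (X : C.Dom), C.scale X = k + 1 → |explZ k U X| ≤ Real.exp (-(κ * C.d X)) * p₀ k)
    (hbase : ∀ g ∈ W, ∀ (U : Bg) (X : C.Dom), C.scale X = 0 → |E g U X| ≤ Real.exp (-(κ * C.d X)) * N 0)
    (hNsucc : ∀ j, p₀ j + 2 * B ≤ N (j + 1)) (hNnn : ∀ j, 0 ≤ N j)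
    (hbox : ∀ (k : ℕ) (Q : ι → ℝ), (∀ y, |Q y| ≤ wt k y * sizeRadius (fun k j => (1 + c) * τ k j) N k) → ρ k Q ∈ 𝒜 k)
    (hB : 0 ≤ B) (hlipb : ∀ k, lip k ≤ lipbar) (hτbar : 0 ≤ τbar) (hω : 0 ≤ ω)
    (hpos : 0 < ω + 8 * lipbar * B * ((1 + c) * τbar))
    (hτ : ∀ k j, j ≤ k → 0 ≤ τ k j ∧ τ k j ≤ τbar * ω ^ (k - j)) :
    TermSize E W κ N ∧
      NE9 E W κ (prodModuli (8 * clipbar * B + 8 * lipbar * B * qTbar)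
        fun _ => ω + 8 * lipbar * B * ((1 + c) * τbar)) ∧
        FadingMemory ((8 * clipbar * B + 8 * lipbar * B * qTbar) / (ω + 8 * lipbar * B * ((1 + c) * τbar)))
          (ω + 8 * lipbar * B * ((1 + c) * τbar))
          (prodModuli (8 * clipbar * B + 8 * lipbar * B * qTbar) fun _ => ω + 8 * lipbar * B * ((1 + c) * τbar)) := by
  have hT : TermSize E W κ N := termSize_compProj G ρ U₀ explZ hAdm hres hPcomm hPinto hPsize hc hsum hstep hfac hreprV hK
    hdec hpin hexplZ hbase hNsucc hNnn hbox
  exact ne9_and_fadingMemory_of_couplingTwoPoint_vacSub_sizeInduction_compProj G ρ U₀ explZ h0 hAdm hres hPadd hPcomm hPinto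
    hPsize hc hadd hsum hstep hfac hclip0 hCup hqT0 (hTcupFed hT) hreprV hclipb hqTb hK hdec hpin hρ hexplZ hbase hNsucc hNnn hbox
    hB hlipb hτbar hω hpos hτ

/-- **END-M `…_margProj` WITH A SIZE-FED `hTcup`** (read-out projection `P := margProj r A`, `c := cr·aA`; RO∕AW binders; `ProjInto`
displayed).  The face A3-REM-END (p213409) and A3-CUR-END (p214812) built by hand, stated once: feed
`fun hT => channelCouplingModulus_cpiece_margProj P … hT …` and the species END with A3 discharged is one `exact`.
[cite: Balaban1987RG1, (0.28)-(0.29) p.258, (1.3) p.260, (1.20)-(1.22) p.264] -/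
theorem termSize_ne9_and_fadingMemory_margProj_fed {E : Functional C Bg} {W : Set (ℕ → ℝ)} {Adm MF : Set (Bg → C.Dom → ℝ)}
    {r : ℕ → (Bg → C.Dom → ℝ) → ℝ} {A : Bg → C.Dom → ℝ} {𝒯 : ℕ → (ℕ → ℝ) → (Bg → C.Dom → ℝ) → ι → ℝ}
    {Ψ : ℕ → ℝ → (ι → ℝ) → Bg → C.Dom → ℝ} {act : ℕ → ℝ → Bg → Pot → G.P → ℂ} {𝒜 : ℕ → Set Pot}
    {n : ℕ → ℝ → Bg → G.P → ℝ} {lip clip : ℕ → ℝ} {a d : G.P → ℝ} {δ : C.Dom → ℝ}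
    {κ B lipbar clipbar qTbar τbar ω cr aA : ℝ} {wt : ℕ → ι → ℝ} {τ : ℕ → ℕ → ℝ} {qT p₀ N : ℕ → ℝ}
    (ρ : ℕ → (ι → ℝ) → Pot) (U₀ : Bg) (explZ : ℕ → Bg → C.Dom → ℝ) (h0 : ScaleZeroFree E W)
    (hAdm : AdmissibleTerms E W Adm) (hres : AdmRestrict Adm)
    (hrA : ReadAdditive Adm r) (hr0 : ReadZero r) (hrs : ReadSize Adm r κ cr) (hA : DirSize A κ aA) (hcr : 0 ≤ cr)
    (haA : 0 ≤ aA) (hPinto : ProjInto Adm MF (margProj r A))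
    (hadd : ChannelAdditive MF 𝒯) (hsum : ChannelStepSum MF 𝒯) (hstep : ChannelSizeAtStepNN MF 𝒯 κ wt τ)
    (hfac : Factorises E W (compProj 𝒯 (margProj r A)) Ψ) (hclip0 : ∀ k, 0 ≤ clip k)
    (hCup : ∀ g ∈ W, ∀ g' ∈ W, ∀ (k : ℕ) (U : Bg) (X : C.Dom), C.scale X = k + 1 → ∀ Q ∈ 𝒜 k, ∀ γ ∈ G.vol X,
      ‖act k (g k) U Q γ‖ ≤ n k (g' k) U γ ∧
        ‖act k (g k) U Q γ - act k (g' k) U Q γ‖ ≤ clip k * |g k - g' k| * n k (g' k) U γ)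
    (hqT0 : ∀ k, 0 ≤ qT k)
    (hTcupFed : TermSize E W κ N → ∀ g ∈ W, ∀ g' ∈ W, ∀ (k : ℕ) (y : ι),
      |compProj 𝒯 (margProj r A) k g (E g) y - compProj 𝒯 (margProj r A) k g' (E g) y| ≤
        wt k y * (qT k * |g k - g' k|))
    (hreprV : ∀ (k : ℕ) (s : ℝ) (Q : ι → ℝ) (U : Bg) (X : C.Dom),
      Ψ k s Q U X = (G.newTerm act k s U X (ρ k Q)).re - (G.newTerm act k s U₀ X (ρ k Q)).re + explZ k U X)
    (hclipb : ∀ k, clip k ≤ clipbar) (hqTb : ∀ k, qT k ≤ qTbar)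
    (hK : TwoPointKP G W act 𝒜 n lip a d) (hdec : G.DecayExtract δ d) (hpin : G.PinBudget a δ (fun _ => B) κ)
    (hρ : ∀ (k : ℕ) (Q Q' : ι → ℝ) (M : ℝ), (∀ y, |Q y - Q' y| ≤ wt k y * M) → ‖ρ k Q - ρ k Q'‖ ≤ M)
    (hexplZ : ∀ (k : ℕ) (U : Bg) (X : C.Dom), C.scale X = k + 1 → |explZ k U X| ≤ Real.exp (-(κ * C.d X)) * p₀ k)
    (hbase : ∀ g ∈ W, ∀ (U : Bg) (X : C.Dom), C.scale X = 0 → |E g U X| ≤ Real.exp (-(κ * C.d X)) * N 0)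
    (hNsucc : ∀ j, p₀ j + 2 * B ≤ N (j + 1)) (hNnn : ∀ j, 0 ≤ N j)
    (hbox : ∀ (k : ℕ) (Q : ι → ℝ),
      (∀ y, |Q y| ≤ wt k y * sizeRadius (fun k j => (1 + cr * aA) * τ k j) N k) → ρ k Q ∈ 𝒜 k)
    (hB : 0 ≤ B) (hlipb : ∀ k, lip k ≤ lipbar) (hτbar : 0 ≤ τbar) (hω : 0 ≤ ω)
    (hpos : 0 < ω + 8 * lipbar * B * ((1 + cr * aA) * τbar))
    (hτ : ∀ k j, j ≤ k → 0 ≤ τ k j ∧ τ k j ≤ τbar * ω ^ (k - j)) :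
    TermSize E W κ N ∧
      NE9 E W κ (prodModuli (8 * clipbar * B + 8 * lipbar * B * qTbar)
        fun _ => ω + 8 * lipbar * B * ((1 + cr * aA) * τbar)) ∧
        FadingMemory ((8 * clipbar * B + 8 * lipbar * B * qTbar) / (ω + 8 * lipbar * B * ((1 + cr * aA) * τbar)))
          (ω + 8 * lipbar * B * ((1 + cr * aA) * τbar))
          (prodModuli (8 * clipbar * B + 8 * lipbar * B * qTbar) fun _ => ω + 8 * lipbar * B * ((1 + cr * aA) * τbar)) :=
  termSize_ne9_and_fadingMemory_compProj_fed G ρ U₀ explZ h0 hAdm hres (projAdditive_margProj A hrA)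
    (projScaleComm_margProj Adm A hr0) hPinto (projSize_margProj hrs hA hcr) (mul_nonneg hcr haA) hadd hsum hstep hfac hclip0
    hCup hqT0 hTcupFed hreprV hclipb hqTb hK hdec hpin hρ hexplZ hbase hNsucc hNnn hbox hB hlipb hτbar hω hpos hτ

/-! ## §3 The ASSEMBLED channel `T_a + T_b` on the read-out dictionary with BOTH coupling moduli size-fed -/

/-- **leaf-04-g6's (w25)-M face for `T_a + T_b` (p214472 §2, `P := margProj r A`) WITH SIZE-FED SUMMAND MODULI (kernel).**  Binders
p214472's VERBATIM except `hTcupa` ∕ `hTcupb` ↦ producers `hTcupaFed` ∕ `hTcupbFed : TermSize E W κ N → (…)`; the size is proved FIRST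
by §1 at `𝒯 := T_a + T_b` (sum binders from leaf-07-g5's `channelStepSum_add` ∕ `channelSizeAtStepNN_add`).  Conclusion p214472's
verbatim (`qTbar := q̄_a + q̄_b`, `ω := max ω_a ω_b`, `τbar := τ̄_a + τ̄_b`).  Sockets: species (a) ↦ §4 below; species (b) ↦ A3-KER's
fed producer (leaf-09 lineage). [cite: Balaban1987RG1, (1.3) p.260, (2.12)-(2.14) p.268; Balaban1988RG2Cluster, (1.33)-(1.36) p.9, (2.14)-(2.15) p.15] -/
theorem termSize_ne9_and_fadingMemory_margProj_sum_fed {E : Functional C Bg} {W : Set (ℕ → ℝ)}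
    {Adm MF : Set (Bg → C.Dom → ℝ)} {r : ℕ → (Bg → C.Dom → ℝ) → ℝ} {A : Bg → C.Dom → ℝ}
    {Ta Tb : ℕ → (ℕ → ℝ) → (Bg → C.Dom → ℝ) → ι → ℝ}
    {Ψ : ℕ → ℝ → (ι → ℝ) → Bg → C.Dom → ℝ} {act : ℕ → ℝ → Bg → Pot → G.P → ℂ} {𝒜 : ℕ → Set Pot}
    {n : ℕ → ℝ → Bg → G.P → ℝ} {lip clip : ℕ → ℝ} {a d : G.P → ℝ} {δ : C.Dom → ℝ}
    {κ B lipbar clipbar qba qbb τba τbb ωa ωb cr aA : ℝ} {wt wta wtb : ℕ → ι → ℝ} {τa τb : ℕ → ℕ → ℝ}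
    {qTa qTb p₀ N : ℕ → ℝ}
    (ρ : ℕ → (ι → ℝ) → Pot) (U₀ : Bg) (explZ : ℕ → Bg → C.Dom → ℝ) (h0 : ScaleZeroFree E W)
    (hAdm : AdmissibleTerms E W Adm) (hres : AdmRestrict Adm)
    (hrA : ReadAdditive Adm r) (hr0 : ReadZero r) (hrs : ReadSize Adm r κ cr) (hA : DirSize A κ aA) (hcr : 0 ≤ cr)
    (haA : 0 ≤ aA) (hPinto : ProjInto Adm MF (margProj r A))
    -- species (a)
    (hadda : ChannelAdditive MF Ta) (hsuma : ChannelStepSum MF Ta) (hstepa : ChannelSizeAtStepNN MF Ta κ wta τa)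
    (hτa : ∀ k j, j ≤ k → 0 ≤ τa k j ∧ τa k j ≤ τba * ωa ^ (k - j)) (hτba : 0 ≤ τba) (hωa : 0 < ωa)
    (hqTa0 : ∀ k, 0 ≤ qTa k) (hqTab : ∀ k, qTa k ≤ qba)
    (hTcupaFed : TermSize E W κ N → ∀ g ∈ W, ∀ g' ∈ W, ∀ (k : ℕ) (y : ι),
      |compProj Ta (margProj r A) k g (E g) y - compProj Ta (margProj r A) k g' (E g) y| ≤
        wta k y * (qTa k * |g k - g' k|))
    -- species (b)
    (haddb : ChannelAdditive MF Tb) (hsumb : ChannelStepSum MF Tb) (hstepb : ChannelSizeAtStepNN MF Tb κ wtb τb)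
    (hτb : ∀ k j, j ≤ k → 0 ≤ τb k j ∧ τb k j ≤ τbb * ωb ^ (k - j)) (hτbb : 0 ≤ τbb) (hωb : 0 ≤ ωb)
    (hqTb0 : ∀ k, 0 ≤ qTb k) (hqTbb : ∀ k, qTb k ≤ qbb)
    (hTcupbFed : TermSize E W κ N → ∀ g ∈ W, ∀ g' ∈ W, ∀ (k : ℕ) (y : ι),
      |compProj Tb (margProj r A) k g (E g) y - compProj Tb (margProj r A) k g' (E g) y| ≤
        wtb k y * (qTb k * |g k - g' k|))
    (hwa : ∀ k y, wta k y ≤ wt k y) (hwb : ∀ k y, wtb k y ≤ wt k y)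
    (hfac : Factorises E W (compProj (Ta + Tb) (margProj r A)) Ψ) (hclip0 : ∀ k, 0 ≤ clip k)
    (hCup : ∀ g ∈ W, ∀ g' ∈ W, ∀ (k : ℕ) (U : Bg) (X : C.Dom), C.scale X = k + 1 → ∀ Q ∈ 𝒜 k, ∀ γ' ∈ G.vol X,
      ‖act k (g k) U Q γ'‖ ≤ n k (g' k) U γ' ∧
        ‖act k (g k) U Q γ' - act k (g' k) U Q γ'‖ ≤ clip k * |g k - g' k| * n k (g' k) U γ')
    (hreprV : ∀ (k : ℕ) (s : ℝ) (Q : ι → ℝ) (U : Bg) (X : C.Dom),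
      Ψ k s Q U X = (G.newTerm act k s U X (ρ k Q)).re - (G.newTerm act k s U₀ X (ρ k Q)).re + explZ k U X)
    (hclipb : ∀ k, clip k ≤ clipbar)
    (hK : TwoPointKP G W act 𝒜 n lip a d) (hdec : G.DecayExtract δ d) (hpin : G.PinBudget a δ (fun _ => B) κ)
    (hρ : ∀ (k : ℕ) (Q Q' : ι → ℝ) (M : ℝ), (∀ y, |Q y - Q' y| ≤ wt k y * M) → ‖ρ k Q - ρ k Q'‖ ≤ M)
    (hexplZ : ∀ (k : ℕ) (U : Bg) (X : C.Dom), C.scale X = k + 1 → |explZ k U X| ≤ Real.exp (-(κ * C.d X)) * p₀ k)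
    (hbase : ∀ g ∈ W, ∀ (U : Bg) (X : C.Dom), C.scale X = 0 → |E g U X| ≤ Real.exp (-(κ * C.d X)) * N 0)
    (hNsucc : ∀ j, p₀ j + 2 * B ≤ N (j + 1)) (hNnn : ∀ j, 0 ≤ N j)
    (hbox : ∀ (k : ℕ) (Q : ι → ℝ),
      (∀ y, |Q y| ≤ wt k y * sizeRadius (fun k j => (1 + cr * aA) * (τa + τb) k j) N k) → ρ k Q ∈ 𝒜 k)
    (hB : 0 ≤ B) (hlipb : ∀ k, lip k ≤ lipbar)
    (hpos : 0 < max ωa ωb + 8 * lipbar * B * ((1 + cr * aA) * (τba + τbb))) :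
    TermSize E W κ N ∧
      NE9 E W κ (prodModuli (8 * clipbar * B + 8 * lipbar * B * (qba + qbb))
        fun _ => max ωa ωb + 8 * lipbar * B * ((1 + cr * aA) * (τba + τbb))) ∧
        FadingMemory ((8 * clipbar * B + 8 * lipbar * B * (qba + qbb)) /
            (max ωa ωb + 8 * lipbar * B * ((1 + cr * aA) * (τba + τbb))))
          (max ωa ωb + 8 * lipbar * B * ((1 + cr * aA) * (τba + τbb)))
          (prodModuli (8 * clipbar * B + 8 * lipbar * B * (qba + qbb))
            fun _ => max ωa ωb + 8 * lipbar * B * ((1 + cr * aA) * (τba + τbb))) := by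
  -- the size FIRST, at the assembled channel (§1 with the sum's one-history binders)
  have hsum := channelStepSum_add hsuma hsumb
  have hstep := channelSizeAtStepNN_add hstepa hstepb hwa hwb (fun k j hjk => (hτa k j hjk).1)
    fun k j hjk => (hτb k j hjk).1
  have hT : TermSize E W κ N := termSize_compProj G ρ U₀ explZ hAdm hres (projScaleComm_margProj Adm A hr0) hPinto
    (projSize_margProj hrs hA hcr) (mul_nonneg hcr haA) hsum hstep hfac hreprV hK hdec hpin hexplZ hbase hNsucc hNnn hbox
  exact termSize_ne9_and_fadingMemory_margProj_sum G ρ U₀ explZ h0 hAdm hres hrA hr0 hrs hA hcr haA hPinto hadda hsuma hstepa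
    hτa hτba hωa hqTa0 hqTab (hTcupaFed hT) haddb hsumb hstepb hτb hτbb hωb hqTb0 hqTbb (hTcupbFed hT) hwa hwb hfac hclip0 hCup
    hreprV hclipb hK hdec hpin hρ hexplZ hbase hNsucc hNnn hbox hB hlipb hpos

end Generic

/-! ## §4 Species (a): the size-fed producer at the CURVE datum on the read-out dictionary -/

section Curve

variable {C₀ : Carriers} {E : Type} [NormedAddCommGroup E] [NormedSpace ℂ E] {ι' α β γ δ : Type} [DecidableEq δ]

/-- **SPECIES (a)'s SIZE-FED COUPLING MODULUS ON THE READ-OUT DICTIONARY (kernel).**  From the (w20) binders of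
`cpieceResponse_cur` — `Dc.Admissible ℓ c_dir d₀`, S1 `Adm ⊆ analyticClass Dc.R` + `E g ∈ Adm`, `0 ≤ cA`, `0 < c_dir`, `0 < ℓ`,
`hhalf`, the slice-curve binders (c1) `hcont`, (c2) `hlip`, (c3) `hroom` — (w19)'s additivity `PieceAdditiveOn (analyticClass Dc.R)
Dc.toC`, AW (`A ∈ analyticClass Dc.R`, `DirSize A κ aA`), `hAmul`, RO `ReadSize Adm r κ cr`, the counts `LevelCountsG … c_Q (ℓ⁵)
(agePow ω)`, `N j ≤ Nbar`: the producer `TermSize Ef W κ N →` leaf A3's `hTcup` at `compProj (cpieceChannel Dc.toC) (margProj r A)`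
with weight `weightOf Dc.toC.frame Dc.κ₁ d₀ O1 (Dc.Kp c_dir)` and the k-uniform constant
`qT := (64·cA·Nbar + cr·Nbar·(64·cA·aA))·c_Q·(1−ω)⁻¹` — p212551 §3 `channelCouplingModulus_cpiece_margProj` fed with
`cpieceResponse_cur` (given the size) and `cpieceResponseA_cur`.  This is the `hTcupaFed` socket of §3 for species (a) (and the
`hTcupFed` socket of §2's `_margProj_fed` for the one-species END).
[cite: Balaban1987RG1, (1.18) p.263, (1.20)-(1.22) p.264, (3.53)-(3.54) p.280; Balaban1988RG2Cluster, (1.21)-(1.29) pp.7-8, (1.33)-(1.36) p.9] -/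
theorem tcupFed_cur_margProj {Dc : CurData C₀ E ι' α β γ δ} {ℓ : ℕ → ℕ → ℝ} {cdir d0 : ℝ} (hD : Dc.Admissible ℓ cdir d0)
    {Ef : Functional (doubleCarriers C₀) E} {W : Set (ℕ → ℝ)} {Adm : Set (E → (doubleCarriers C₀).Dom → ℝ)}
    {r : ℕ → (E → (doubleCarriers C₀).Dom → ℝ) → ℝ} {A : E → (doubleCarriers C₀).Dom → ℝ}
    {κ O1 cQ ω cA Nbar cr aA : ℝ} {N : ℕ → ℝ}
    (hAdmAn : Adm ⊆ analyticClass Dc.R) (hAdmE : ∀ g ∈ W, Ef g ∈ Adm)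
    (hA16 : PieceAdditiveOn (analyticClass Dc.R) Dc.toC)
    (hAan : A ∈ analyticClass Dc.R) (hA : DirSize A κ aA) (haA : 0 ≤ aA)
    (hAmul : ∀ c : ℕ → ℝ, (fun U X' => c ((doubleCarriers C₀).scale X') * A U X') ∈ Adm)
    (hrs : ReadSize Adm r κ cr) (hcr : 0 ≤ cr) (hNnn : ∀ j, 0 ≤ N j) (hNb : ∀ j, N j ≤ Nbar)
    (hcA : 0 ≤ cA) (hcdir : 0 < cdir) (hℓ : ∀ k j, 0 < ℓ k j) (hhalf : ∀ k j, cdir * ℓ k j < 1 / 2)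
    (hcont : ∀ (k : ℕ) (s : ℕ → ℝ) (y : ι') (a : α) (b : β) (x : (doubleCarriers C₀).Dom),
      ContinuousOn (fun q : (ℂ × ((δ → ℝ) × (δ → ℂ))) × ℂ => Dc.cur k s y a b x q.1.1 q.1.2.1 q.1.2.2 q.2)
        ((sphere (0:ℂ) (Dc.r k) ×ˢ {q | OnContour Dc.κ₁ (Dc.cubes k y a b) q.1 q.2}) ×ˢ sphere (0:ℂ) 1))
    (hlip : ∀ g ∈ W, ∀ g' ∈ W, ∀ (k : ℕ) (y : ι'), ∀ a ∈ Dc.S0 k y, ∀ b ∈ Dc.SY k y a, ∀ (j : ℕ), ∀ x ∈ Dc.src k y a j,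
      ∀ t ∈ sphere (0:ℂ) (Dc.r k), ∀ (s' : δ → ℝ) (σ' : δ → ℂ), OnContour Dc.κ₁ (Dc.cubes k y a b) s' σ' →
        ∀ τ ∈ ball (0:ℂ) (1 / (2 * (cdir * ℓ k j))),
          ‖Dc.cur k g y a b x t s' σ' τ - Dc.cur k g' y a b x t s' σ' τ‖ ≤ cA * (Dc.R x.1 / 2) * |g k - g' k|)
    (hroom : ∀ g ∈ W, ∀ (k : ℕ) (y : ι'), ∀ a ∈ Dc.S0 k y, ∀ b ∈ Dc.SY k y a, ∀ (j : ℕ), ∀ x ∈ Dc.src k y a j,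
      ∀ t ∈ sphere (0:ℂ) (Dc.r k), ∀ (s' : δ → ℝ) (σ' : δ → ℂ), OnContour Dc.κ₁ (Dc.cubes k y a b) s' σ' →
        ∀ τ ∈ ball (0:ℂ) (1 / (2 * (cdir * ℓ k j))), ‖Dc.cur k g y a b x t s' σ' τ‖ ≤ Dc.R x.1 / 2)
    (hL : LevelCountsG Dc.toC.frame κ Dc.κ₁ O1 cQ (fun k j => ℓ k j ^ 5) (agePow ω)) (hO1 : 0 ≤ O1) (hcQ : 0 ≤ cQ)
    (hω0 : 0 ≤ ω) (hω1 : ω < 1) :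
    TermSize Ef W κ N → ∀ g ∈ W, ∀ g' ∈ W, ∀ (k : ℕ) (y : ι'),
      |compProj (cpieceChannel Dc.toC) (margProj r A) k g (Ef g) y -
          compProj (cpieceChannel Dc.toC) (margProj r A) k g' (Ef g) y| ≤
        weightOf Dc.toC.frame Dc.κ₁ d0 O1 (Dc.Kp cdir) k y *
          ((64 * cA * Nbar + cr * Nbar * (64 * cA * aA)) * cQ * (1 - ω)⁻¹ * |g k - g' k|) := by
  intro hT
  have hE : ∀ g ∈ W, Ef g ∈ analyticClass Dc.R := fun g hg => hAdmAn (hAdmE g hg)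
  have hNbar : 0 ≤ Nbar := (hNnn 0).trans (hNb 0)
  have hPA : PieceAdditiveOn Adm Dc.toC := pieceAdditiveOn_mono hAdmAn hA16
  exact channelCouplingModulus_cpiece_margProj Dc.toC hPA hAdmE hAmul
    (cpieceResponse_cur hD hE hT hNnn hNb hcA hcdir hℓ hhalf hcont hlip hroom)
    (cpieceResponseA_cur hD (W := W) hAan hA haA hcA hcdir hℓ hhalf hcont hlip hroom) hrs hT hNnn hNb hcr hL (kp_nonneg hD)
    (by positivity) (by positivity) hO1 (fun k j => pow_nonneg (hℓ k j).le 5) hcQ hω0 hω1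

end Curve

end Summit.QuantumFields.BalabanUV.T4Continuum.NE9SizeFedCoupling

end
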